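import Summits.Ventures.YMGap.Thresholds.OneLinkRecentredPoisson
import Summits.Ventures.YMGap.Thresholds.OneLinkRemainderPrime
import Summits.Ventures.YMGap.Thresholds.OneLinkPoissonCovariance
import Summits.Ventures.YMGap.Thresholds.OneLinkLevelTwoCovariance
import HarnessLib

/-!
# Venture YMGap — the one-link modulus beyond first order, part 59: the RECENTRED SPLIT of the level-two decomposition — the `hdec`
# input of the tree engine `cov_linear_le_of_poisson_split` with `ψ := ψ₂ + δψ` (fourth foundation file of the mean-field recentring
# lever, cell notes `HOME/p2/ONE-LINK-HIERARCHY.md` §16 (α), `HOME/p2/hier/LEAN-SPEC-RECENTRING.md` §6)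

HONEST FRAMING: venture file of the cell `pub-ymgap` (QuantumFields programme), strong-coupling LATTICE bookkeeping for `SU(N)`
lattice Yang–Mills; nothing about the continuum or the mass gap in the Clay sense.  Pure matrix calculus, no measure, no number of
record.  WHAT.  `OneLinkPoissonCovarianceSplit.cov_linear_le_of_poisson_split` is abstract in the Poisson datum `(ψ, c, M)` through
`hdec : ∀ g, Δψ(g) + NΓ(Re tr(·B), Re tr(·Δ))(g) + NΓ(Re tr(·B), ψ)(g) = κ + Re tr(g M) + N c(g)`.  The tree feeds it with
`ψ = ψ₂`, `c = c₃′` (`OneLinkRemainderPrime.c3_split`).  With the recentring correction `δψ` (`OneLinkRecentredPoisson.Lap_deltaPsi`: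
`Δδψ = −N c₃⁽ᵐ⁾`, `c₃⁽ᵐ⁾` = the mean part of `c₃′` for arbitrary complex `m₁, m₂`):
* `contDiff_deltaPsi`;
* ★ `c3hat_split`: `Δ(ψ₂ + δψ) + NΓ(Re tr(·B), Re tr(·Δ)) + NΓ(Re tr(·B), ψ₂ + δψ) = κ + Re tr(g·N M_ℓ) + N·(ĉ₃′(g) + Γ(Re tr(·B), δψ)(g))`
  with `ĉ₃′` the RECENTRED non-linear remainder of `OneLinkRecentredRemainder.Gam_c3hat_le` (its `Z`-scales are fluctuations) — so the
  engine applies verbatim with `ψ := ψ₂ + δψ`, `c := ĉ₃′ + Γ(Re tr(·B), δψ)`; what remains for the lever is the gradient bound of the small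
  feedback `Γ(Re tr(·B), δψ)` and the assembly (spec §6).
References: cell notes above.
-/

noncomputable section

open scoped Matrix ComplexConjugate BigOperators
open Matrix Complex Finset
open Literature.MathematicalPhysics.QuantumFieldTheory
open Literature.MathematicalPhysics.QuantumFieldTheory.SUNBakryEmery

namespace Summit.Ventures.YMGap.OneLinkEigen

variable {N : ℕ}

section Calc

open scoped Matrix.Norms.Frobenius ContDiff Topology

/-! ### The recentred split (the `hdec` input of the tree engine `cov_linear_le_of_poisson_split`) -/

/-- The recentring Poisson correction `δψ` (`OneLinkRecentredPoisson.Lap_deltaPsi`) is smooth. [folklore] -/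
theorem contDiff_deltaPsi (N : ℕ) (B Δ : Matrix (Fin N) (Fin N) ℂ) (m₁ m₂ : ℂ) :
    ContDiff ℝ ∞ (fun Q : Matrix (Fin N) (Fin N) ℂ =>
        (-2 * ((N : ℝ) ^ 2 / (4 * ((N : ℝ) ^ 2 - 4))) * m₁.im) *
            ((-(2 * (N : ℝ) - 4 / N) * (Q * Δ * Q * B).trace.im + 2 * ((Q * B).trace * (Q * Δ).trace).im)
              / ((2 * (N : ℝ) - 4 / N) ^ 2 - 4))
        + ((N : ℝ) / 2) *
            ((((N : ℝ) / (2 * ((N : ℝ) ^ 2 - 4))) - 1 / (4 * (N : ℝ))) * m₂.re *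
                ((-(2 * (N : ℝ) - 4 / N) * (Q * B * Q * B).trace.re + 2 * ((Q * B).trace * (Q * B).trace).re)
                  / ((2 * (N : ℝ) - 4 / N) ^ 2 - 4))
              - (((N : ℝ) / (2 * ((N : ℝ) ^ 2 - 4))) + 1 / (4 * (N : ℝ))) * m₂.im *
                ((-(2 * (N : ℝ) - 4 / N) * (Q * B * Q * B).trace.im + 2 * ((Q * B).trace * (Q * B).trace).im)
                  / ((2 * (N : ℝ) - 4 / N) ^ 2 - 4)))
        + ((N : ℝ) / 2) *
            ((((N : ℝ) / (2 * ((N : ℝ) ^ 2 - 4))) - 1 / (4 * (N : ℝ))) * m₁.re *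
                ((-(2 * (N : ℝ) - 4 / N) * (Q * Δ * Q * B).trace.re + 2 * ((Q * B).trace * (Q * Δ).trace).re)
                  / ((2 * (N : ℝ) - 4 / N) ^ 2 - 4))
              - (((N : ℝ) / (2 * ((N : ℝ) ^ 2 - 4))) + 1 / (4 * (N : ℝ))) * m₁.im *
                ((-(2 * (N : ℝ) - 4 / N) * (Q * Δ * Q * B).trace.im + 2 * ((Q * B).trace * (Q * Δ).trace).im)
                  / ((2 * (N : ℝ) - 4 / N) ^ 2 - 4)))
        + (2 * ((N : ℝ) / (2 * ((N : ℝ) ^ 2 - 4))) * m₁.im) *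
            ((-(2 * (N : ℝ) - 4 / N) * ((Q * B).trace * (Q * Δ).trace).im + 2 * (Q * Δ * Q * B).trace.im)
              / ((2 * (N : ℝ) - 4 / N) ^ 2 - 4))) := by
  have hWr := contDiff_reTrQuad (N := N) Δ B
  have hWi := contDiff_imTrQuad (N := N) Δ B
  have hTr := contDiff_reTrProd (N := N) B Δ
  have hTi := contDiff_imTrProd (N := N) B Δ
  have hBBr := contDiff_reTrQuad (N := N) B B
  have hBBi := contDiff_imTrQuad (N := N) B B
  have hZZr := contDiff_reTrProd (N := N) B B
  have hZZi := contDiff_imTrProd (N := N) B B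
  exact (((contDiff_const.mul (((contDiff_const.mul hWi).add (contDiff_const.mul hTi)).div_const _)).add
      (contDiff_const.mul ((contDiff_const.mul (((contDiff_const.mul hBBr).add (contDiff_const.mul hZZr)).div_const _)).sub
        (contDiff_const.mul (((contDiff_const.mul hBBi).add (contDiff_const.mul hZZi)).div_const _))))).add
      (contDiff_const.mul ((contDiff_const.mul (((contDiff_const.mul hWr).add (contDiff_const.mul hTr)).div_const _)).sub
        (contDiff_const.mul (((contDiff_const.mul hWi).add (contDiff_const.mul hTi)).div_const _))))).add
      (contDiff_const.mul (((contDiff_const.mul hTi).add (contDiff_const.mul hWi)).div_const _))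

/-- **THE RECENTRED SPLIT of the level-two decomposition on `SU(N)`** (`N ≥ 3`, arbitrary complex `m₁, m₂`):
`Δ_LB(ψ₂ + δψ) + NΓ(Re tr(·B), Re tr(·Δ)) + NΓ(Re tr(·B), ψ₂ + δψ) = (N − 1/N)/2 · Re tr(BΔᴴ) + Re tr(g·(N M_ℓ)) + N·(ĉ₃′(g) + Γ(Re tr(·B), δψ)(g))`
— the tree's `c3_split` plus `Lap_deltaPsi`: the hypothesis `hdec` of `OneLinkPoissonCovarianceSplit.cov_linear_le_of_poisson_split` with
`ψ := ψ₂ + δψ` and `c := ĉ₃′ + Γ(Re tr(·B), δψ)`, i.e. the mean part of the cubic remainder has moved into the Poisson solution and only the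
RECENTRED remainder `ĉ₃′` (`Gam_c3hat_le`) and the small feedback `Γ(Re tr(·B), δψ)` are left for Bakry–Émery. [folklore] -/
theorem c3hat_split (hN : 3 ≤ N) (B Δ : Matrix (Fin N) (Fin N) ℂ) (m₁ m₂ : ℂ) (g : SUN N) :
    Lap ((fun Q : Matrix (Fin N) (Fin N) ℂ =>
        -((N : ℝ) ^ 2 / (4 * ((N : ℝ) ^ 2 - 4))) * (Q * Δ * Q * B).trace.re
          + ((N : ℝ) / (2 * ((N : ℝ) ^ 2 - 4))) * ((Q * B).trace * (Q * Δ).trace).re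
          - (1 / (4 * (N : ℝ))) * ((Q * B).trace * (starRingEnd ℂ) (Q * Δ).trace).re) + (fun Q : Matrix (Fin N) (Fin N) ℂ =>
        (-2 * ((N : ℝ) ^ 2 / (4 * ((N : ℝ) ^ 2 - 4))) * m₁.im) *
            ((-(2 * (N : ℝ) - 4 / N) * (Q * Δ * Q * B).trace.im + 2 * ((Q * B).trace * (Q * Δ).trace).im)
              / ((2 * (N : ℝ) - 4 / N) ^ 2 - 4))
        + ((N : ℝ) / 2) *
            ((((N : ℝ) / (2 * ((N : ℝ) ^ 2 - 4))) - 1 / (4 * (N : ℝ))) * m₂.re *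
                ((-(2 * (N : ℝ) - 4 / N) * (Q * B * Q * B).trace.re + 2 * ((Q * B).trace * (Q * B).trace).re)
                  / ((2 * (N : ℝ) - 4 / N) ^ 2 - 4))
              - (((N : ℝ) / (2 * ((N : ℝ) ^ 2 - 4))) + 1 / (4 * (N : ℝ))) * m₂.im *
                ((-(2 * (N : ℝ) - 4 / N) * (Q * B * Q * B).trace.im + 2 * ((Q * B).trace * (Q * B).trace).im)
                  / ((2 * (N : ℝ) - 4 / N) ^ 2 - 4)))
        + ((N : ℝ) / 2) *
            ((((N : ℝ) / (2 * ((N : ℝ) ^ 2 - 4))) - 1 / (4 * (N : ℝ))) * m₁.re *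
                ((-(2 * (N : ℝ) - 4 / N) * (Q * Δ * Q * B).trace.re + 2 * ((Q * B).trace * (Q * Δ).trace).re)
                  / ((2 * (N : ℝ) - 4 / N) ^ 2 - 4))
              - (((N : ℝ) / (2 * ((N : ℝ) ^ 2 - 4))) + 1 / (4 * (N : ℝ))) * m₁.im *
                ((-(2 * (N : ℝ) - 4 / N) * (Q * Δ * Q * B).trace.im + 2 * ((Q * B).trace * (Q * Δ).trace).im)
                  / ((2 * (N : ℝ) - 4 / N) ^ 2 - 4)))
        + (2 * ((N : ℝ) / (2 * ((N : ℝ) ^ 2 - 4))) * m₁.im) *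
            ((-(2 * (N : ℝ) - 4 / N) * ((Q * B).trace * (Q * Δ).trace).im + 2 * (Q * Δ * Q * B).trace.im)
              / ((2 * (N : ℝ) - 4 / N) ^ 2 - 4)))) g
        + (N : ℝ) * Gam (pot 1 B) (pot 1 Δ) g
        + (N : ℝ) * Gam (pot 1 B) ((fun Q : Matrix (Fin N) (Fin N) ℂ =>
        -((N : ℝ) ^ 2 / (4 * ((N : ℝ) ^ 2 - 4))) * (Q * Δ * Q * B).trace.re
          + ((N : ℝ) / (2 * ((N : ℝ) ^ 2 - 4))) * ((Q * B).trace * (Q * Δ).trace).re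
          - (1 / (4 * (N : ℝ))) * ((Q * B).trace * (starRingEnd ℂ) (Q * Δ).trace).re) + (fun Q : Matrix (Fin N) (Fin N) ℂ =>
        (-2 * ((N : ℝ) ^ 2 / (4 * ((N : ℝ) ^ 2 - 4))) * m₁.im) *
            ((-(2 * (N : ℝ) - 4 / N) * (Q * Δ * Q * B).trace.im + 2 * ((Q * B).trace * (Q * Δ).trace).im)
              / ((2 * (N : ℝ) - 4 / N) ^ 2 - 4))
        + ((N : ℝ) / 2) *
            ((((N : ℝ) / (2 * ((N : ℝ) ^ 2 - 4))) - 1 / (4 * (N : ℝ))) * m₂.re *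
                ((-(2 * (N : ℝ) - 4 / N) * (Q * B * Q * B).trace.re + 2 * ((Q * B).trace * (Q * B).trace).re)
                  / ((2 * (N : ℝ) - 4 / N) ^ 2 - 4))
              - (((N : ℝ) / (2 * ((N : ℝ) ^ 2 - 4))) + 1 / (4 * (N : ℝ))) * m₂.im *
                ((-(2 * (N : ℝ) - 4 / N) * (Q * B * Q * B).trace.im + 2 * ((Q * B).trace * (Q * B).trace).im)
                  / ((2 * (N : ℝ) - 4 / N) ^ 2 - 4)))
        + ((N : ℝ) / 2) *
            ((((N : ℝ) / (2 * ((N : ℝ) ^ 2 - 4))) - 1 / (4 * (N : ℝ))) * m₁.re *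
                ((-(2 * (N : ℝ) - 4 / N) * (Q * Δ * Q * B).trace.re + 2 * ((Q * B).trace * (Q * Δ).trace).re)
                  / ((2 * (N : ℝ) - 4 / N) ^ 2 - 4))
              - (((N : ℝ) / (2 * ((N : ℝ) ^ 2 - 4))) + 1 / (4 * (N : ℝ))) * m₁.im *
                ((-(2 * (N : ℝ) - 4 / N) * (Q * Δ * Q * B).trace.im + 2 * ((Q * B).trace * (Q * Δ).trace).im)
                  / ((2 * (N : ℝ) - 4 / N) ^ 2 - 4)))
        + (2 * ((N : ℝ) / (2 * ((N : ℝ) ^ 2 - 4))) * m₁.im) *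
            ((-(2 * (N : ℝ) - 4 / N) * ((Q * B).trace * (Q * Δ).trace).im + 2 * (Q * Δ * Q * B).trace.im)
              / ((2 * (N : ℝ) - 4 / N) ^ 2 - 4)))) g =
      (((N : ℝ) - 1 / N) / 2) * (B * Δᴴ).trace.re
        + pot 1 ((N : ℂ) • ((-((((N : ℝ) ^ 2 / (4 * ((N : ℝ) ^ 2 - 4))) / 2 : ℝ) : ℂ)) • (B * Bᴴ * Δ + Δ * Bᴴ * B)
          + ((1 / 2 : ℝ) : ℂ) • (((((N : ℝ) / (2 * ((N : ℝ) ^ 2 - 4)) : ℝ) : ℂ) * (B * Bᴴ).trace - ((1 / (4 * (N : ℝ)) : ℝ) : ℂ) * (starRingEnd ℂ) (B * Bᴴ).trace) • Δ + ((((N : ℝ) / (2 * ((N : ℝ) ^ 2 - 4)) : ℝ) : ℂ) * (Δ * Bᴴ).trace - ((1 / (4 * (N : ℝ)) : ℝ) : ℂ) * (starRingEnd ℂ) (Δ * Bᴴ).trace) • B))) (g : Matrix (Fin N) (Fin N) ℂ)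
        + (N : ℝ) * ((fun Q : Matrix (Fin N) (Fin N) ℂ =>
      ((N : ℝ) ^ 2 / (4 * ((N : ℝ) ^ 2 - 4))) / 2 *
          ((Q * B * Q * Δ * Q * B).trace.re + (Q * B * Q * B * Q * Δ).trace.re)
        + 2 * ((N : ℝ) ^ 2 / (4 * ((N : ℝ) ^ 2 - 4))) / N * ((Q * B).trace - m₁).im * (Q * Δ * Q * B).trace.im
        - 1 / 2 * ((Q * B * Q * B).trace *
            ((((N : ℝ) / (2 * ((N : ℝ) ^ 2 - 4)) : ℝ) : ℂ) * ((Q * Δ).trace - m₂)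
              - ((1 / (4 * (N : ℝ)) : ℝ) : ℂ) * (starRingEnd ℂ) ((Q * Δ).trace - m₂))).re
        - 1 / 2 * ((Q * Δ * Q * B).trace *
            ((((N : ℝ) / (2 * ((N : ℝ) ^ 2 - 4)) : ℝ) : ℂ) * ((Q * B).trace - m₁)
              - ((1 / (4 * (N : ℝ)) : ℝ) : ℂ) * (starRingEnd ℂ) ((Q * B).trace - m₁))).re
        - 2 * ((N : ℝ) / (2 * ((N : ℝ) ^ 2 - 4))) / N *
          ((Q * B).trace - m₁).im * ((Q * B).trace * (Q * Δ).trace).im) g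
          + Gam (pot 1 B) (fun Q : Matrix (Fin N) (Fin N) ℂ =>
        (-2 * ((N : ℝ) ^ 2 / (4 * ((N : ℝ) ^ 2 - 4))) * m₁.im) *
            ((-(2 * (N : ℝ) - 4 / N) * (Q * Δ * Q * B).trace.im + 2 * ((Q * B).trace * (Q * Δ).trace).im)
              / ((2 * (N : ℝ) - 4 / N) ^ 2 - 4))
        + ((N : ℝ) / 2) *
            ((((N : ℝ) / (2 * ((N : ℝ) ^ 2 - 4))) - 1 / (4 * (N : ℝ))) * m₂.re *
                ((-(2 * (N : ℝ) - 4 / N) * (Q * B * Q * B).trace.re + 2 * ((Q * B).trace * (Q * B).trace).re)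
                  / ((2 * (N : ℝ) - 4 / N) ^ 2 - 4))
              - (((N : ℝ) / (2 * ((N : ℝ) ^ 2 - 4))) + 1 / (4 * (N : ℝ))) * m₂.im *
                ((-(2 * (N : ℝ) - 4 / N) * (Q * B * Q * B).trace.im + 2 * ((Q * B).trace * (Q * B).trace).im)
                  / ((2 * (N : ℝ) - 4 / N) ^ 2 - 4)))
        + ((N : ℝ) / 2) *
            ((((N : ℝ) / (2 * ((N : ℝ) ^ 2 - 4))) - 1 / (4 * (N : ℝ))) * m₁.re *
                ((-(2 * (N : ℝ) - 4 / N) * (Q * Δ * Q * B).trace.re + 2 * ((Q * B).trace * (Q * Δ).trace).re)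
                  / ((2 * (N : ℝ) - 4 / N) ^ 2 - 4))
              - (((N : ℝ) / (2 * ((N : ℝ) ^ 2 - 4))) + 1 / (4 * (N : ℝ))) * m₁.im *
                ((-(2 * (N : ℝ) - 4 / N) * (Q * Δ * Q * B).trace.im + 2 * ((Q * B).trace * (Q * Δ).trace).im)
                  / ((2 * (N : ℝ) - 4 / N) ^ 2 - 4)))
        + (2 * ((N : ℝ) / (2 * ((N : ℝ) ^ 2 - 4))) * m₁.im) *
            ((-(2 * (N : ℝ) - 4 / N) * ((Q * B).trace * (Q * Δ).trace).im + 2 * (Q * Δ * Q * B).trace.im)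
              / ((2 * (N : ℝ) - 4 / N) ^ 2 - 4))) g) := by
  have hN0 : N ≠ 0 := by omega
  have hψ := contDiff_psiTwo N B Δ
  have hδ := contDiff_deltaPsi N B Δ m₁ m₂
  rw [Lap_add hψ hδ, Pi.add_apply, Gam_add_right (pot 1 B) hψ hδ]
  have hsplit := c3_split hN B Δ g
  have hδψ := congrFun (Lap_deltaPsi hN B Δ m₁ m₂) (g : Matrix (Fin N) (Fin N) ℂ)
  rw [hδψ]
  simp only [mul_re, mul_im, sub_re, sub_im, conj_re, conj_im, ofReal_re, ofReal_im] at hsplit ⊢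
  linear_combination hsplit

end Calc

end Summit.Ventures.YMGap.OneLinkEigen
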